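import Literature.Probability.Percolation.PlanarDuality
import Literature.Probability.Percolation.SitePaths
import Literature.Probability.LatticeModels.TriangularLattice
import HarnessLib

/-!
# Horizontal and vertical crossings of a parallelogram of `𝕋` meet

Topic `Literature/Probability/Percolation`; family `crit-perc` (site percolation on the
triangular lattice `𝕋 = triGraph`). The basic planar-topology input of every
Russo–Seymour–Welsh gluing argument and of every "closed circuits block open paths" argument on
the triangular lattice (Kesten 1982, §2.2–2.3 and Prop. 2.2; Grimmett 1999, §11.7–11.8;
Bollobás–Riordan 2006, Ch. 5, Lemma 5.9 / Ch. 7; Werner 2009, Lecture 2): in a lattice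
parallelogram `[L, R] × [B, T]` of `𝕋`, **every left-right `𝕋`-path meets every top-bottom
`𝕋`-path in a common site**. In print this is "obvious from a picture" (Jordan curve theorem).

We give a combinatorial proof by REDUCTION to the square-lattice statement
`Literature.Probability.Percolation.exists_mem_support_of_crossing` of `PlanarDuality.lean` (a horizontal and a
vertical `ℤ²`-walk crossing a rectangle share a vertex), through the *doubling refinement*:
a site `s` of `𝕋` is sent to `2s ∈ ℤ²`, and each of the six kinds of edges of `𝕋` to a
`ℤ²`-walk of length `2` or `4` between the doubled endpoints (`exists_refineWalk_of_adj`):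
`s → s ± e₀`, `s → s ± e₁` become the straight walks through the doubled midpoint, and the
diagonal `(x, y+1) → (x+1, y)` of the unit square `[x, x+1] × [y, y+1]` becomes the staircase
`(2x, 2y+2) → (2x+1, 2y+2) → (2x+1, 2y+1) → (2x+2, 2y+1) → (2x+2, 2y)`. The map
`triHalve : ℤ² → 𝕋` (`(2a, 2b), (2a+1, 2b), (2a, 2b+1) ↦ (a, b)` and `(2a+1, 2b+1) ↦ (a+1, b)`)
sends every vertex of the refinement of an edge `{s, t}` back to `s` or `t`
(`exists_refineWalk_of_adj`), because two distinct edges of `𝕋` whose refinements share a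
vertex share an endpoint. Hence a common vertex `v` of the refinements of a `𝕋`-path with sites
in `A` and of a `𝕋`-path with sites in `A'` yields the common site `triHalve v ∈ A ∩ A'`
(`PathIn.tri_crossings_meet`). Paths are the `PathIn triGraph A x y` of `SitePaths.lean`.

Contents: `triDouble`, `triHalve` (definitions with `simp` API), `triGraph_adj_cases`
(the six steps of `𝕋` in coordinates), `exists_refineWalk_of_adj`,
`exists_refineWalk_of_pathIn`, and the theorem `PathIn.tri_crossings_meet` (with the
symmetric variant `PathIn.tri_crossings_meet'` where the first path is vertical).

Mathlib: `SimpleGraph.Walk` (`cons`, `append`, `support`); no planar topology or percolation in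
Mathlib. Tree: `exists_mem_support_of_crossing`, `zdGraph_two_adj_iff` (`PlanarDuality.lean`),
`triGraph_adj_iff` (`TriangularLattice.lean`), `PathIn` (`SitePaths.lean`).

## References
* H. Kesten, *Percolation theory for mathematicians*, Birkhäuser (1982), §2.2–2.3, Prop. 2.2
  [KestenPTM1982].
* G. Grimmett, *Percolation*, 2nd ed. (1999), §11.7 (proof of the RSW lemma: "the left-right
  crossing … must intersect the top-bottom crossing") [GrimmettPercolation1999].
-/

namespace Literature.Probability.Percolation

open SimpleGraph

noncomputable section

/-! ### The doubling refinement `𝕋 → ℤ²` and its retraction -/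

/-- The doubled site `2s ∈ ℤ²` of a site `s` of `𝕋`. [folklore] -/
def triDouble (s : LatticeModels.Site 2) : LatticeModels.Site 2 := ![2 * s 0, 2 * s 1]

/-- Coordinates of `triDouble`. [folklore] -/
@[simp] theorem triDouble_apply_zero (s : LatticeModels.Site 2) : triDouble s 0 = 2 * s 0 := rfl

/-- Coordinates of `triDouble`. [folklore] -/
@[simp] theorem triDouble_apply_one (s : LatticeModels.Site 2) : triDouble s 1 = 2 * s 1 := rfl

/-- The retraction `ℤ² → 𝕋` of the doubling refinement: `(2a, 2b)`, `(2a+1, 2b)` and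
`(2a, 2b+1)` go to `(a, b)`, and the centre `(2a+1, 2b+1)` of the doubled unit square goes to
`(a+1, b)`, an endpoint of the only edge of `𝕋` refined through it (the diagonal
`(a, b+1) → (a+1, b)`). [folklore] -/
def triHalve (v : LatticeModels.Site 2) : LatticeModels.Site 2 :=
  ![v 0 / 2 + (if v 0 % 2 = 1 ∧ v 1 % 2 = 1 then 1 else 0), v 1 / 2]

/-- First coordinate of `triHalve`. [folklore] -/
@[simp] theorem triHalve_apply_zero (v : LatticeModels.Site 2) :
    triHalve v 0 = v 0 / 2 + (if v 0 % 2 = 1 ∧ v 1 % 2 = 1 then 1 else 0) := rfl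

/-- Second coordinate of `triHalve`. [folklore] -/
@[simp] theorem triHalve_apply_one (v : LatticeModels.Site 2) : triHalve v 1 = v 1 / 2 := rfl

/-- `triHalve` retracts `triDouble`. [folklore] -/
@[simp] theorem triHalve_triDouble (s : LatticeModels.Site 2) : triHalve (triDouble s) = s := by
  rw [LatticeModels.Site.eq_iff_two]
  simp only [triHalve_apply_zero, triDouble_apply_zero, triDouble_apply_one, triHalve_apply_one]
  constructor
  · split_ifs with h <;> omega
  · omega

/-- The six steps of `𝕋` in coordinates: `± e₀`, `± e₁`, `± (e₀ - e₁)`. [folklore] -/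
theorem triGraph_adj_cases {s t : LatticeModels.Site 2} (h : LatticeModels.triGraph.Adj s t) :
    (t 0 = s 0 + 1 ∧ t 1 = s 1) ∨ (s 0 = t 0 + 1 ∧ t 1 = s 1) ∨
      (t 1 = s 1 + 1 ∧ t 0 = s 0) ∨ (s 1 = t 1 + 1 ∧ t 0 = s 0) ∨
      (t 0 = s 0 + 1 ∧ s 1 = t 1 + 1) ∨ (s 0 = t 0 + 1 ∧ t 1 = s 1 + 1) := by
  rcases (LatticeModels.triGraph_adj_iff s t).1 h with h | h | h
  · rcases (zdGraph_two_adj_iff s t).1 h with h | h | h | h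
    · exact Or.inl h
    · exact Or.inr (Or.inl h)
    · exact Or.inr (Or.inr (Or.inl h))
    · exact Or.inr (Or.inr (Or.inr (Or.inl h)))
  · have h0 := congrFun h 0
    have h1 := congrFun h 1
    simp only [Pi.add_apply, LatticeModels.triDiag_zero, LatticeModels.triDiag_one] at h0 h1
    exact Or.inr (Or.inr (Or.inr (Or.inr (Or.inl ⟨h0, by omega⟩))))
  · have h0 := congrFun h 0
    have h1 := congrFun h 1
    simp only [Pi.add_apply, LatticeModels.triDiag_zero, LatticeModels.triDiag_one] at h0 h1
    exact Or.inr (Or.inr (Or.inr (Or.inr (Or.inr ⟨h0, by omega⟩))))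

/-- Adjacency of two explicit points of `ℤ²` from their coordinates. [folklore] -/
theorem zdGraph_two_adj_of_coord {x y : LatticeModels.Site 2}
    (h : (y 0 = x 0 + 1 ∧ y 1 = x 1) ∨ (x 0 = y 0 + 1 ∧ y 1 = x 1) ∨
      (y 1 = x 1 + 1 ∧ y 0 = x 0) ∨ (x 1 = y 1 + 1 ∧ y 0 = x 0)) : (LatticeModels.zdGraph 2).Adj x y :=
  (zdGraph_two_adj_iff x y).2 h

/-- The property of a vertex `v` of the refinement of the edge `{s, t}` used below: `v` retracts
to `s` or `t`, and lies in the bounding box of `2s`, `2t`. [folklore] -/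
def RefineGood (s t v : LatticeModels.Site 2) : Prop :=
  (triHalve v = s ∨ triHalve v = t) ∧
    (min (2 * s 0) (2 * t 0) ≤ v 0 ∧ v 0 ≤ max (2 * s 0) (2 * t 0)) ∧
      (min (2 * s 1) (2 * t 1) ≤ v 1 ∧ v 1 ≤ max (2 * s 1) (2 * t 1))

/-- A two-step refinement walk `2s → m → 2t`. [folklore] -/
theorem exists_refineWalk_two {s t : LatticeModels.Site 2} (m : LatticeModels.Site 2)
    (h₁ : (LatticeModels.zdGraph 2).Adj (triDouble s) m) (h₂ : (LatticeModels.zdGraph 2).Adj m (triDouble t))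
    (hm : RefineGood s t m) :
    ∃ W : (LatticeModels.zdGraph 2).Walk (triDouble s) (triDouble t), ∀ v ∈ W.support, RefineGood s t v := by
  refine ⟨Walk.cons h₁ (Walk.cons h₂ Walk.nil), fun v hv => ?_⟩
  simp only [Walk.support_cons, Walk.support_nil, List.mem_cons, List.not_mem_nil,
    or_false] at hv
  rcases hv with rfl | rfl | rfl
  · exact ⟨Or.inl (triHalve_triDouble s),
      by simp only [triDouble_apply_zero]; omega, by simp only [triDouble_apply_one]; omega⟩
  · exact hm
  · exact ⟨Or.inr (triHalve_triDouble t),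
      by simp only [triDouble_apply_zero]; omega, by simp only [triDouble_apply_one]; omega⟩

/-- A four-step refinement walk `2s → m₁ → m₂ → m₃ → 2t`. [folklore] -/
theorem exists_refineWalk_four {s t : LatticeModels.Site 2} (m₁ m₂ m₃ : LatticeModels.Site 2)
    (h₁ : (LatticeModels.zdGraph 2).Adj (triDouble s) m₁) (h₂ : (LatticeModels.zdGraph 2).Adj m₁ m₂)
    (h₃ : (LatticeModels.zdGraph 2).Adj m₂ m₃) (h₄ : (LatticeModels.zdGraph 2).Adj m₃ (triDouble t))
    (hm₁ : RefineGood s t m₁) (hm₂ : RefineGood s t m₂) (hm₃ : RefineGood s t m₃) :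
    ∃ W : (LatticeModels.zdGraph 2).Walk (triDouble s) (triDouble t), ∀ v ∈ W.support, RefineGood s t v := by
  refine ⟨Walk.cons h₁ (Walk.cons h₂ (Walk.cons h₃ (Walk.cons h₄ Walk.nil))), fun v hv => ?_⟩
  simp only [Walk.support_cons, Walk.support_nil, List.mem_cons, List.not_mem_nil,
    or_false] at hv
  rcases hv with rfl | rfl | rfl | rfl | rfl
  · exact ⟨Or.inl (triHalve_triDouble s),
      by simp only [triDouble_apply_zero]; omega, by simp only [triDouble_apply_one]; omega⟩
  · exact hm₁
  · exact hm₂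
  · exact hm₃
  · exact ⟨Or.inr (triHalve_triDouble t),
      by simp only [triDouble_apply_zero]; omega, by simp only [triDouble_apply_one]; omega⟩

/-- **Refinement of one edge of `𝕋`.** For adjacent sites `s ∼ t` of `𝕋` there is a `ℤ²`-walk
from `2s` to `2t` all of whose vertices retract (under `triHalve`) to `s` or `t` and lie in the
bounding box of `2s, 2t`: the straight two-step walk for the four axis steps, and the staircase
through the centre of the doubled unit square for the two diagonal steps. [folklore] -/
theorem exists_refineWalk_of_adj {s t : LatticeModels.Site 2} (h : LatticeModels.triGraph.Adj s t) :
    ∃ W : (LatticeModels.zdGraph 2).Walk (triDouble s) (triDouble t), ∀ v ∈ W.support, RefineGood s t v := by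
  rcases triGraph_adj_cases h with ⟨h0, h1⟩ | ⟨h0, h1⟩ | ⟨h1, h0⟩ | ⟨h1, h0⟩ | ⟨h0, h1⟩ | ⟨h0, h1⟩
  · -- `t = s + e₀`: `2s → 2s + e₀ → 2t`
    refine exists_refineWalk_two ![2 * s 0 + 1, 2 * s 1] ?_ ?_ ⟨Or.inl ?_, ?_, ?_⟩
    · exact zdGraph_two_adj_of_coord (Or.inl ⟨by simp; try omega, by simp; try omega⟩)
    · exact zdGraph_two_adj_of_coord (Or.inl ⟨by simp; try omega, by simp; try omega⟩)
    · rw [LatticeModels.Site.eq_iff_two]; simp only [triHalve_apply_zero, triHalve_apply_one,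
        Matrix.cons_val_zero, Matrix.cons_val_one]
      constructor
      · split_ifs with hc <;> omega
      · omega
    · simp only [Matrix.cons_val_zero]; omega
    · simp only [Matrix.cons_val_one, Matrix.cons_val_fin_one]; omega
  · -- `t = s - e₀`: `2s → 2s - e₀ → 2t`
    refine exists_refineWalk_two ![2 * s 0 - 1, 2 * s 1] ?_ ?_ ⟨Or.inr ?_, ?_, ?_⟩
    · exact zdGraph_two_adj_of_coord (Or.inr (Or.inl ⟨by simp; try omega, by simp; try omega⟩))
    · exact zdGraph_two_adj_of_coord (Or.inr (Or.inl ⟨by simp; try omega, by simp; try omega⟩))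
    · rw [LatticeModels.Site.eq_iff_two]; simp only [triHalve_apply_zero, triHalve_apply_one,
        Matrix.cons_val_zero, Matrix.cons_val_one]
      constructor
      · split_ifs with hc <;> omega
      · omega
    · simp only [Matrix.cons_val_zero]; omega
    · simp only [Matrix.cons_val_one, Matrix.cons_val_fin_one]; omega
  · -- `t = s + e₁`: `2s → 2s + e₁ → 2t`
    refine exists_refineWalk_two ![2 * s 0, 2 * s 1 + 1] ?_ ?_ ⟨Or.inl ?_, ?_, ?_⟩
    · exact zdGraph_two_adj_of_coord (Or.inr (Or.inr (Or.inl ⟨by simp; try omega, by simp; try omega⟩)))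
    · exact zdGraph_two_adj_of_coord (Or.inr (Or.inr (Or.inl ⟨by simp; try omega, by simp; try omega⟩)))
    · rw [LatticeModels.Site.eq_iff_two]; simp only [triHalve_apply_zero, triHalve_apply_one,
        Matrix.cons_val_zero, Matrix.cons_val_one]
      constructor
      · split_ifs with hc <;> omega
      · omega
    · simp only [Matrix.cons_val_zero]; omega
    · simp only [Matrix.cons_val_one, Matrix.cons_val_fin_one]; omega
  · -- `t = s - e₁`: `2s → 2s - e₁ → 2t`
    refine exists_refineWalk_two ![2 * s 0, 2 * s 1 - 1] ?_ ?_ ⟨Or.inr ?_, ?_, ?_⟩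
    · exact zdGraph_two_adj_of_coord (Or.inr (Or.inr (Or.inr ⟨by simp; try omega, by simp; try omega⟩)))
    · exact zdGraph_two_adj_of_coord (Or.inr (Or.inr (Or.inr ⟨by simp; try omega, by simp; try omega⟩)))
    · rw [LatticeModels.Site.eq_iff_two]; simp only [triHalve_apply_zero, triHalve_apply_one,
        Matrix.cons_val_zero, Matrix.cons_val_one]
      constructor
      · split_ifs with hc <;> omega
      · omega
    · simp only [Matrix.cons_val_zero]; omega
    · simp only [Matrix.cons_val_one, Matrix.cons_val_fin_one]; omega
  · -- the diagonal `t = s + e₀ - e₁`: `2s → 2s + e₀ → 2s + e₀ - e₁ → 2s + 2e₀ - e₁ → 2t`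
    refine exists_refineWalk_four ![2 * s 0 + 1, 2 * s 1] ![2 * s 0 + 1, 2 * s 1 - 1]
      ![2 * s 0 + 2, 2 * s 1 - 1] ?_ ?_ ?_ ?_ ⟨Or.inl ?_, ?_, ?_⟩ ⟨Or.inr ?_, ?_, ?_⟩
      ⟨Or.inr ?_, ?_, ?_⟩
    · exact zdGraph_two_adj_of_coord (Or.inl ⟨by simp; try omega, by simp; try omega⟩)
    · exact zdGraph_two_adj_of_coord (Or.inr (Or.inr (Or.inr ⟨by simp; try omega, by simp; try omega⟩)))
    · exact zdGraph_two_adj_of_coord (Or.inl ⟨by simp; try omega, by simp; try omega⟩)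
    · exact zdGraph_two_adj_of_coord (Or.inr (Or.inr (Or.inr ⟨by simp; try omega, by simp; try omega⟩)))
    · rw [LatticeModels.Site.eq_iff_two]; simp only [triHalve_apply_zero, triHalve_apply_one,
        Matrix.cons_val_zero, Matrix.cons_val_one]
      constructor
      · split_ifs with hc <;> omega
      · omega
    · simp only [Matrix.cons_val_zero]; omega
    · simp only [Matrix.cons_val_one, Matrix.cons_val_fin_one]; omega
    · rw [LatticeModels.Site.eq_iff_two]; simp only [triHalve_apply_zero, triHalve_apply_one,
        Matrix.cons_val_zero, Matrix.cons_val_one]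
      constructor
      · split_ifs with hc <;> omega
      · omega
    · simp only [Matrix.cons_val_zero]; omega
    · simp only [Matrix.cons_val_one, Matrix.cons_val_fin_one]; omega
    · rw [LatticeModels.Site.eq_iff_two]; simp only [triHalve_apply_zero, triHalve_apply_one,
        Matrix.cons_val_zero, Matrix.cons_val_one]
      constructor
      · split_ifs with hc <;> omega
      · omega
    · simp only [Matrix.cons_val_zero]; omega
    · simp only [Matrix.cons_val_one, Matrix.cons_val_fin_one]; omega
  · -- the diagonal `t = s - e₀ + e₁`: `2s → 2s + e₁ → 2s - e₀ + e₁ → 2s - e₀ + 2e₁ → 2t`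
    refine exists_refineWalk_four ![2 * s 0, 2 * s 1 + 1] ![2 * s 0 - 1, 2 * s 1 + 1]
      ![2 * s 0 - 1, 2 * s 1 + 2] ?_ ?_ ?_ ?_ ⟨Or.inl ?_, ?_, ?_⟩ ⟨Or.inl ?_, ?_, ?_⟩
      ⟨Or.inr ?_, ?_, ?_⟩
    · exact zdGraph_two_adj_of_coord (Or.inr (Or.inr (Or.inl ⟨by simp; try omega, by simp; try omega⟩)))
    · exact zdGraph_two_adj_of_coord (Or.inr (Or.inl ⟨by simp; try omega, by simp; try omega⟩))
    · exact zdGraph_two_adj_of_coord (Or.inr (Or.inr (Or.inl ⟨by simp; try omega, by simp; try omega⟩)))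
    · exact zdGraph_two_adj_of_coord (Or.inr (Or.inl ⟨by simp; try omega, by simp; try omega⟩))
    · rw [LatticeModels.Site.eq_iff_two]; simp only [triHalve_apply_zero, triHalve_apply_one,
        Matrix.cons_val_zero, Matrix.cons_val_one]
      constructor
      · split_ifs with hc <;> omega
      · omega
    · simp only [Matrix.cons_val_zero]; omega
    · simp only [Matrix.cons_val_one, Matrix.cons_val_fin_one]; omega
    · rw [LatticeModels.Site.eq_iff_two]; simp only [triHalve_apply_zero, triHalve_apply_one,
        Matrix.cons_val_zero, Matrix.cons_val_one]
      constructor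
      · split_ifs with hc <;> omega
      · omega
    · simp only [Matrix.cons_val_zero]; omega
    · simp only [Matrix.cons_val_one, Matrix.cons_val_fin_one]; omega
    · rw [LatticeModels.Site.eq_iff_two]; simp only [triHalve_apply_zero, triHalve_apply_one,
        Matrix.cons_val_zero, Matrix.cons_val_one]
      constructor
      · split_ifs with hc <;> omega
      · omega
    · simp only [Matrix.cons_val_zero]; omega
    · simp only [Matrix.cons_val_one, Matrix.cons_val_fin_one]; omega

/-- **Refinement of a `𝕋`-path.** A `𝕋`-path with all its sites in `A ⊆ [L, R] × [B, T]` from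
`x` to `y` has a refinement: a `ℤ²`-walk from `2x` to `2y` inside `[2L, 2R] × [2B, 2T]` all of
whose vertices retract into `A`. [folklore] -/
theorem exists_refineWalk_of_pathIn {A : Set (LatticeModels.Site 2)} {L R B T : ℤ}
    (hA : ∀ z ∈ A, L ≤ z 0 ∧ z 0 ≤ R ∧ B ≤ z 1 ∧ z 1 ≤ T) {x y : LatticeModels.Site 2}
    (h : PathIn LatticeModels.triGraph A x y) :
    ∃ W : (LatticeModels.zdGraph 2).Walk (triDouble x) (triDouble y), ∀ v ∈ W.support,
      triHalve v ∈ A ∧ 2 * L ≤ v 0 ∧ v 0 ≤ 2 * R ∧ 2 * B ≤ v 1 ∧ v 1 ≤ 2 * T := by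
  obtain ⟨hx, hxy⟩ := h
  induction hxy with
  | refl =>
    refine ⟨Walk.nil, fun v hv => ?_⟩
    simp only [Walk.support_nil, List.mem_cons, List.not_mem_nil, or_false] at hv
    subst hv
    have := hA x hx
    refine ⟨by rwa [triHalve_triDouble], ?_⟩
    simp only [triDouble_apply_zero, triDouble_apply_one]
    omega
  | @tail b c hxb hbc ih =>
    obtain ⟨W, hW⟩ := ih
    have hb : b ∈ A := PathIn.right_mem (⟨hx, hxb⟩ : PathIn LatticeModels.triGraph A x b)
    obtain ⟨W', hW'⟩ := exists_refineWalk_of_adj hbc.1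
    refine ⟨W.append W', fun v hv => ?_⟩
    rw [Walk.mem_support_append_iff] at hv
    rcases hv with hv | hv
    · exact hW v hv
    · obtain ⟨hret, hbox⟩ := hW' v hv
      have hbA := hA b hb
      have hcA := hA c hbc.2
      refine ⟨?_, ?_⟩
      · rcases hret with h | h <;> rw [h]
        · exact hb
        · exact hbc.2
      · obtain ⟨h0, h1⟩ := hbox
        simp only [min_le_iff, le_max_iff] at h0 h1
        omega

/-- **A left-right and a top-bottom `𝕋`-path of a parallelogram meet.** Let
`A, A' ⊆ [L, R] × [B, T]` be sets of sites of `𝕋`. If some `𝕋`-path with sites in `A` joins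
the left side `{x₀ = L}` to the right side `{x₀ = R}` and some `𝕋`-path with sites in `A'`
joins the bottom side `{x₁ = B}` to the top side `{x₁ = T}`, then `A ∩ A'` is nonempty: the
two paths have a common site. (Kesten 1982, §2.2–2.3; Grimmett 1999, §11.7, "the left-right
crossing must intersect the top-bottom crossing"; proved here by the doubling refinement and
`exists_mem_support_of_crossing`.) [cite: KestenPTM1982, §2.2 (paths crossing a rectangle must intersect)] -/
theorem PathIn.tri_crossings_meet {L R B T : ℤ} {A A' : Set (LatticeModels.Site 2)} {a b c d : LatticeModels.Site 2}
    (hA : ∀ z ∈ A, L ≤ z 0 ∧ z 0 ≤ R ∧ B ≤ z 1 ∧ z 1 ≤ T)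
    (hA' : ∀ z ∈ A', L ≤ z 0 ∧ z 0 ≤ R ∧ B ≤ z 1 ∧ z 1 ≤ T)
    (hP : PathIn LatticeModels.triGraph A a b) (ha : a 0 = L) (hb : b 0 = R)
    (hQ : PathIn LatticeModels.triGraph A' c d) (hc : c 1 = B) (hd : d 1 = T) :
    ∃ z, z ∈ A ∧ z ∈ A' := by
  obtain ⟨P, hPsub⟩ := exists_refineWalk_of_pathIn hA hP
  obtain ⟨Q, hQsub⟩ := exists_refineWalk_of_pathIn hA' hQ
  obtain ⟨v, hvP, hvQ⟩ := exists_mem_support_of_crossing (L := 2 * L) (R := 2 * R) (B := 2 * B)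
    (T := 2 * T) P Q (fun z hz => (hPsub z hz).2) (fun z hz => (hQsub z hz).2)
    (by simp [ha]) (by simp [hb]) (by simp [hc]) (by simp [hd])
  exact ⟨triHalve v, (hPsub v hvP).1, (hQsub v hvQ).1⟩

/-- The same with the roles exchanged: a top-bottom path with sites in `A` and a left-right path
with sites in `A'` have a common site. [cite: KestenPTM1982, §2.2 (paths crossing a rectangle must intersect)] -/
theorem PathIn.tri_crossings_meet' {L R B T : ℤ} {A A' : Set (LatticeModels.Site 2)} {a b c d : LatticeModels.Site 2}
    (hA : ∀ z ∈ A, L ≤ z 0 ∧ z 0 ≤ R ∧ B ≤ z 1 ∧ z 1 ≤ T)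
    (hA' : ∀ z ∈ A', L ≤ z 0 ∧ z 0 ≤ R ∧ B ≤ z 1 ∧ z 1 ≤ T)
    (hP : PathIn LatticeModels.triGraph A a b) (ha : a 1 = B) (hb : b 1 = T)
    (hQ : PathIn LatticeModels.triGraph A' c d) (hc : c 0 = L) (hd : d 0 = R) :
    ∃ z, z ∈ A ∧ z ∈ A' := by
  obtain ⟨z, hz', hz⟩ := PathIn.tri_crossings_meet hA' hA hQ hc hd hP ha hb
  exact ⟨z, hz, hz'⟩

end

end Literature.Probability.Percolation
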